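import Literature.NumberTheory.Rogawski1990.AdelicStableOrbitalEulerDischargeG2OfKConj
import Literature.NumberTheory.Rogawski1990.AdelicStableOrbitalEulerDischargeSemisimple
import HarnessLib

/-!
# The (G2)-kernel Euler discharge on `U(H₂)(𝐀)` AT A SPLIT SEMISIMPLE CLASS `(γ₀ − a)(γ₀ − b) = 0`, `a ≠ b` — the K6-ζ (ζ1) head with its O7 binders CLOSED BY NAME
# (row O7, K6-ζ (ζ1′); in particular the `G′`-side `H₁ = H₂ = H` of the anisotropic inner form at singular ∕ central classes)
(Rogawski, *Automorphic Representations of Unitary Groups in Three Variables* (1990), §3.3 p. 21, §3.8 Prop. 3.8.1 p. 27, §4.3 p. 44, §5.4 (5.4.3) pp. 72–73;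
Kottwitz, *Stable trace formula: elliptic singular terms* (1986), Prop. 7.1, Cor. 7.3)

Topic `NumberTheory/Rogawski1990`; namespace `Literature.NumberTheory.Rogawski1990`.  THEOREMS ONLY: no definition, no named fact, no instance, no notation,
no `sorry`.  Cell `pub/hodgecm-mathlib`, ENGINE T1 (crux H413 = `stmt-HodgeConjecture-24833`), row O7, piece **K6-ζ (ζ1′)** (O7 OWNER WORD #10 (2) ∕ #11 (1)); the
two-form twin of ★ K6-δ′ `AdelicStableOrbitalEulerDischargeSemisimple`, whose §1 transport lemmas it reuses.

THE POINT.  ★ K6-ζ (ζ1) `MatchingAdeleG₂.exists_isEulerOnClasses_ofLocalAdelic_of_eventuallyKConj` leaves three O7 binders: the relative `K_v`-conjugacy clause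
`hKrel` on `U(H₂)` and the closed `GL_3`-orbits `hO`, `hOi` of the correspondent `γ ∈ U(H₂)(L⁺)`.  At a split semisimple `γ₀ ∈ U(H₁)(L⁺)` all three are ★:
`hKrel` is Kottwitz 7.1 at the SEMISIMPLE correspondent `γ` (★ FILE 3 `eventually_forall_integralConj_cmDatum_of_isSemisimpleElt` at `H₂`, made relative — two
integral elements corresponding to `(γ₀)_v` are both `K_v`-conjugate to `γ_v`), `hO` is ★ ε2 and `hOi` is ★ ε∞ at the relation `(γ − a)(γ − b) = 0` transported
from `γ₀` (★ K6-δ′ §1).  The head keeps only the kit-side binders (class-local admissibility, normalisation, `hFi`).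

* §1 `MatchingAdeleG₂.eventuallyKConj_rel_of_isSemisimpleElt` — the relative clause on `U(H₂)` at a semisimple pair.
* §2 **`MatchingAdeleG₂.exists_isEulerOnClasses_ofLocalAdelic_of_mul_sub_eq_zero`**.

HC_CM is proved only modulo the printed citations until rung 0 closes; this file consumes nothing printed.

## References
* [Rogawski1990] J. D. Rogawski, *Automorphic Representations of Unitary Groups in Three Variables*, Ann. of Math. Stud. 123 (1990), §3.3 p. 21, §3.8
  Prop. 3.8.1 p. 27, §4.3 p. 44, §5.4 (5.4.3) pp. 72–73.
* [Kottwitz1986] R. E. Kottwitz, *Stable trace formula: elliptic singular terms*, Math. Ann. 275 (1986), Prop. 7.1, Cor. 7.3, §7.3.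
* [GetzHahn2024] J. R. Getz, H. Hahn, *An Introduction to Automorphic Representations*, GTM 300 (2024), Thm. 17.4.1.
-/

set_option autoImplicit false

noncomputable section

open NumberField IsDedekindDomain Filter Function MeasureTheory
open scoped Matrix MatrixGroups

namespace Literature.NumberTheory.Rogawski1990

open Literature.NumberTheory.Automorphic Literature.LinearAlgebra.Matrix Literature.MeasureTheory.Group
open Literature.AlgebraicGeometry.ShimuraVarieties (unitaryGroup)

/-! ## §1 The relative clause on `U(H₂)` at a semisimple pair -/

section Clause

variable {L : Type} [Field L] [NumberField L] [IsCMField L] {H₁ H₂ : Matrix (Fin 3) (Fin 3) L}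
  {γ₀ : (UnitaryGroup.cmDatum L 3 H₁).Rational} {γ : (UnitaryGroup.cmDatum L 3 H₂).Rational}

/-- **Kottwitz 7.1, relative `K_v`-form on `U(H₂)`, at a SEMISIMPLE pair** (no regularity): for `γ₀ ↔ γ` with `γ ∈ U(H₂)(L⁺)` semisimple, a.e. `v`, two elements of
`K_v = U(H₂)(𝒪_v)` corresponding to `(γ₀)_v` are `K_v`-conjugate — both are `K_v`-conjugate to `γ_v` by ★ FILE 3 `eventually_forall_integralConj_cmDatum_of_isSemisimpleElt`
(`(γ₀)_v ↔ γ_v`, ★ `corresponds_toLocal_toAdelic`).  The semisimple twin of ★ `MatchingAdeleG₂.eventually_forall_exists_conj`; the binder `hKrel` of ★ K6-ζ (ζ1).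
[cite: Rogawski1990, §3.3 p. 21; §3.8 p. 27] [cite: Kottwitz1986, Prop. 7.1, Cor. 7.3] -/
theorem MatchingAdeleG₂.eventuallyKConj_rel_of_isSemisimpleElt (hH₂ : (H₂.map (cmConjRingHom L))ᵀ = H₂) (hdet : H₂.det ≠ 0)
    (hγ : Corresponds (cmConjRingHom L) H₁ H₂ γ₀ γ) (hss : IsSemisimpleElt (cmConjRingHom L) H₂ γ) :
    ∀ᶠ v in cofinite, ∀ g g' : (UnitaryGroup.cmDatum L 3 H₂).Local v,
      g ∈ UnitaryGroup.cmLocalIntegralLevel L 3 H₂ v → g' ∈ UnitaryGroup.cmLocalIntegralLevel L 3 H₂ v →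
        Corresponds (UnitaryGroup.conjLocal L (IsCMField.complexConj L) v) ((UnitaryGroup.adelicForm L 3 H₁).map (UnitaryGroup.adeleToLocal L v))
          ((UnitaryGroup.adelicForm L 3 H₂).map (UnitaryGroup.adeleToLocal L v)) ((UnitaryGroup.cmDatum L 3 H₁).toLocal v ((UnitaryGroup.cmDatum L 3 H₁).toAdelic γ₀)) g →
        Corresponds (UnitaryGroup.conjLocal L (IsCMField.complexConj L) v) ((UnitaryGroup.adelicForm L 3 H₁).map (UnitaryGroup.adeleToLocal L v))
          ((UnitaryGroup.adelicForm L 3 H₂).map (UnitaryGroup.adeleToLocal L v)) ((UnitaryGroup.cmDatum L 3 H₁).toLocal v ((UnitaryGroup.cmDatum L 3 H₁).toAdelic γ₀)) g' →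
          ∃ k ∈ UnitaryGroup.cmLocalIntegralLevel L 3 H₂ v, k * g * k⁻¹ = g' := by
  filter_upwards [eventually_forall_integralConj_cmDatum_of_isSemisimpleElt L H₂ hH₂ hdet γ hss] with v hv g g' hg hg' hc hc'
  obtain ⟨k₁, hk₁, e₁⟩ := hv g hg (IsConj.symm ((corresponds_toLocal_toAdelic hγ v).isStablyConj_right hc))
  obtain ⟨k₂, hk₂, e₂⟩ := hv g' hg' (IsConj.symm ((corresponds_toLocal_toAdelic hγ v).isStablyConj_right hc'))
  refine ⟨k₂ * k₁⁻¹, mul_mem hk₂ (inv_mem hk₁), ?_⟩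
  rw [← e₁, ← e₂]
  group

end Clause

/-! ## §2 The head at a split semisimple class -/

section Discharge


variable {L : Type} [Field L] [NumberField L] [IsCMField L] {H₁ H₂ : Matrix (Fin 3) (Fin 3) L}
  {γ₀ : (UnitaryGroup.cmDatum L 3 H₁).Rational} {γ : (UnitaryGroup.cmDatum L 3 H₂).Rational}
  [∀ g : (UnitaryGroup.cmDatum L 3 H₂).Adelic,
    MeasurableSpace ((UnitaryGroup.cmDatum L 3 H₂).Adelic ⧸ Subgroup.centralizer ({g} : Set (UnitaryGroup.cmDatum L 3 H₂).Adelic))]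
  [∀ g : (UnitaryGroup.cmDatum L 3 H₂).Adelic,
    BorelSpace ((UnitaryGroup.cmDatum L 3 H₂).Adelic ⧸ Subgroup.centralizer ({g} : Set (UnitaryGroup.cmDatum L 3 H₂).Adelic))]
  [∀ (v : HeightOneSpectrum (𝓞 ↥(maximalRealSubfield L))) (x : (UnitaryGroup.cmDatum L 3 H₂).Local v),
    MeasurableSpace ((UnitaryGroup.cmDatum L 3 H₂).Local v ⧸ Subgroup.centralizer ({x} : Set ((UnitaryGroup.cmDatum L 3 H₂).Local v)))]
  [∀ (v : HeightOneSpectrum (𝓞 ↥(maximalRealSubfield L))) (x : (UnitaryGroup.cmDatum L 3 H₂).Local v),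
    BorelSpace ((UnitaryGroup.cmDatum L 3 H₂).Local v ⧸ Subgroup.centralizer ({x} : Set ((UnitaryGroup.cmDatum L 3 H₂).Local v)))]
  [∀ a : UnitaryGroup.arch (↥(maximalRealSubfield L)) L (IsCMField.complexConj L) 3 H₂,
    MeasurableSpace (UnitaryGroup.arch (↥(maximalRealSubfield L)) L (IsCMField.complexConj L) 3 H₂ ⧸
      Subgroup.centralizer ({a} : Set (UnitaryGroup.arch (↥(maximalRealSubfield L)) L (IsCMField.complexConj L) 3 H₂)))]
  [∀ a : UnitaryGroup.arch (↥(maximalRealSubfield L)) L (IsCMField.complexConj L) 3 H₂,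
    BorelSpace (UnitaryGroup.arch (↥(maximalRealSubfield L)) L (IsCMField.complexConj L) 3 H₂ ⧸
      Subgroup.centralizer ({a} : Set (UnitaryGroup.arch (↥(maximalRealSubfield L)) L (IsCMField.complexConj L) 3 H₂)))]

/-- **THE (G2)-KERNEL EULER DISCHARGE AT A SPLIT SEMISIMPLE CLASS.**  `H₂` hermitian with `det H₂ ≠ 0`; `γ₀ ∈ U(H₁)(L⁺)` with `(γ₀ − a)(γ₀ − b) = 0`, `a ≠ b ∈ L`
(every singular semisimple or central element of the anisotropic `U(H₁)`); `γ ∈ U(H₂)(L⁺)` a rational correspondent; `mq v`, `mqi` admissible on the classes corresponding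
to `(γ₀)_v` ∕ `γ₀ ⊗ 1`; `mq` normalised off a finite set at `toAdelic γ` and at every matching adèle; an `IsTest` pure tensor `T` on `U(H₂)(𝐀)` with integrable orbital
integrands at the classes of `𝒞_𝐀(γ₀)`.  THEN `∃ S₁, ∀ S ⊇ S₁, IsEulerOnClasses (MatchingAdeleG₂.classes L H₁ H₂ γ₀) (ofLocalAdelic L 3 H₂ mq mqi) T.eval S (v ↦ Φ^st_v(γ_v))
(Φ^st_∞(γ ⊗ 1))` — ★ K6-ζ (ζ1) with `hKrel := eventuallyKConj_rel_of_isSemisimpleElt` (§1; semisimplicity of `γ` by ★ ε1 at the transported relation), `hO v := ★ ε2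
isClosed_conjClass_localGL_of_mul_sub_eq_zero`, `hOi := ★ ε∞ isClosed_conjClass_mixedSpaceGL_of_mul_sub_eq_zero` (relation transported and localised by ★ K6-δ′ §1).
For `H₁ = H₂ = H` anisotropic this is the `G′`-side Euler reading at every singular ∕ central class. [cite: Rogawski1990, §3.3 p. 21; §3.8 Prop. 3.8.1 p. 27; §4.3 p. 44;
§5.4 (5.4.3) pp. 72–73] [cite: Kottwitz1986, Prop. 7.1, Cor. 7.3] -/
theorem MatchingAdeleG₂.exists_isEulerOnClasses_ofLocalAdelic_of_mul_sub_eq_zero (hH₂ : (H₂.map (cmConjRingHom L))ᵀ = H₂) (hdet : H₂.det ≠ 0)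
    (hγ : Corresponds (cmConjRingHom L) H₁ H₂ γ₀ γ)
    {a b : L} (hab : a ≠ b)
    (hγab : ((((γ₀ : unitaryGroup (cmConjRingHom L) H₁).val : GL (Fin 3) L).val : Matrix (Fin 3) (Fin 3) L) - a • (1 : Matrix (Fin 3) (Fin 3) L)) *
      ((((γ₀ : unitaryGroup (cmConjRingHom L) H₁).val : GL (Fin 3) L).val : Matrix (Fin 3) (Fin 3) L) - b • (1 : Matrix (Fin 3) (Fin 3) L)) = 0)
    (mq : ∀ v : HeightOneSpectrum (𝓞 ↥(maximalRealSubfield L)),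
      OrbitalMeasureFamily ((UnitaryGroup.cmDatum L 3 H₂).Local v))
    (mqi : OrbitalMeasureFamily (UnitaryGroup.arch (↥(maximalRealSubfield L)) L (IsCMField.complexConj L) 3
      H₂))
    (hadm : ∀ v, (mq v).IsAdmissibleOn fun x : (UnitaryGroup.cmDatum L 3 H₂).Local v =>
      Corresponds (UnitaryGroup.conjLocal L (IsCMField.complexConj L) v)
        ((UnitaryGroup.adelicForm L 3 H₁).map (UnitaryGroup.adeleToLocal L v))
        ((UnitaryGroup.adelicForm L 3 H₂).map (UnitaryGroup.adeleToLocal L v))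
        ((UnitaryGroup.cmDatum L 3 H₁).toLocal v ((UnitaryGroup.cmDatum L 3 H₁).toAdelic γ₀)) x)
    (hadmA : mqi.IsAdmissibleOn fun a : UnitaryGroup.arch (↥(maximalRealSubfield L)) L (IsCMField.complexConj L) 3 H₂ =>
      Corresponds (UnitaryGroup.conjMixed (↥(maximalRealSubfield L)) L (IsCMField.complexConj L)) (UnitaryGroup.archFormOf L 3 H₁)
        (UnitaryGroup.archFormOf L 3 H₂) (cmRationalToArch L 3 H₁ γ₀) a)
    (hnormγ : ∃ S₀ : Finset (HeightOneSpectrum (𝓞 ↥(maximalRealSubfield L))),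
      UnitaryGroup.IsNormalisedOff L 3 H₂ mq
        ((UnitaryGroup.cmDatum L 3 H₂).toAdelic γ) S₀)
    (hnorm : ∀ p : MatchingAdeleG₂ L H₁ H₂ γ₀, ∃ S₀ : Finset (HeightOneSpectrum (𝓞 ↥(maximalRealSubfield L))),
      UnitaryGroup.IsNormalisedOff L 3 H₂ mq p.adele S₀)
    (T : UnitaryGroup.PureTensor L 3 H₂) (hT : T.IsTest)
    (hFi : ∀ c ∈ MatchingAdeleG₂.classes L H₁ H₂ γ₀, Integrable
      (descConj (Quotient.out c : (UnitaryGroup.cmDatum L 3 H₂).Adelic)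
        (Subgroup.centralizer ({(Quotient.out c : (UnitaryGroup.cmDatum L 3 H₂).Adelic)} :
          Set (UnitaryGroup.cmDatum L 3 H₂).Adelic))
        (centralizer_comm _) T.eval)
      (UnitaryGroup.OrbitalMeasureFamily.ofLocalAdelic L 3 H₂ mq mqi c)) :
    ∃ S₁ : Finset (HeightOneSpectrum (𝓞 ↥(maximalRealSubfield L))), ∀ S : Finset (HeightOneSpectrum (𝓞 ↥(maximalRealSubfield L))), S₁ ⊆ S →
      IsEulerOnClasses (MatchingAdeleG₂.classes L H₁ H₂ γ₀)
        (UnitaryGroup.OrbitalMeasureFamily.ofLocalAdelic L 3 H₂ mq mqi) T.eval S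
        (fun v => localStableOrbitalIntegral L 3 H₂ v (mq v) (T.loc v)
          ((UnitaryGroup.cmDatum L 3 H₂).toLocal v
            ((UnitaryGroup.cmDatum L 3 H₂).toAdelic γ)))
        (archStableOrbitalIntegral L 3 H₂ mqi T.arch
          (cmRationalToArch L 3 H₂ γ)) := by
  -- the relation at the correspondent `γ` (conjugate to `γ₀` in `GL_3(L)`), semisimplicity of `γ`
  have hγab' := mul_sub_smul_mul_sub_smul_eq_zero_of_isConj hγ hγab
  have hss : IsSemisimpleElt (cmConjRingHom L) H₂ γ := isSemisimple_toLin'_of_mul_sub_eq_zero hab hγab'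
  exact MatchingAdeleG₂.exists_isEulerOnClasses_ofLocalAdelic_of_eventuallyKConj hH₂ hdet hγ
    (MatchingAdeleG₂.eventuallyKConj_rel_of_isSemisimpleElt hH₂ hdet hγ hss) mq mqi hadm hadmA
    (fun v => UnitaryGroup.isClosed_conjClass_localGL_of_mul_sub_eq_zero 3 v _ (isUnit_algebraMap_localRing_sub v hab)
      (mul_sub_smul_toLocal_toAdelic_eq_zero v γ hγab'))
    (UnitaryGroup.isClosed_conjClass_mixedSpaceGL_of_mul_sub_eq_zero L 3 _ (isUnit_mixedEmbedding_sub hab)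
      (mul_sub_smul_cmRationalToArch_eq_zero γ hγab'))
    hnormγ hnorm T hT hFi

end Discharge

end Literature.NumberTheory.Rogawski1990

end
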